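import Summits.ValiantsHypothesis.ValiantsHypothesis.Theorems.BarrierLeverAnchoredDoorHitsLowerPairsStarMassMerge

/-!
# Route BarrierLever — support item `AnchoredDoorHitsLowerPairs` (stmt-ValiantsHypothesis-22510), line `anchored_peeling`:
# NODE TEXT «CUMULATIVE-MASS ORDER» (corrects …StarMassMerge: merge by ABSOLUTE cumulative mass, not by fractions)

Node file (`--supports stmt-ValiantsHypothesis-22510`; val-np-p1 g36). Closes NO item; nothing here bears on crux 14610 or on `VP ≠ VNP`, which is
NOT proved; `Stmt.conjStarLower` / `Stmt.conjStarOrdered` are NOT proved here.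

CORRECTION OF RECORD. The node `Stmt.conjStarMassMerge` of …StarMassMerge (merge of the two mass-sorted sides by cumulative mass FRACTION) is
NUMERICALLY REFUTED (val-np-p1 g36, lab/exp28–31, the same session that filed it): on the deep-versus-wide pairs (2^[6] minus 8 top faces, B(10,2))
(r = 56), (2^[7] ∖ ↑{p,q}, B(13,2) + 4 triangles) (r = 96), (2^[7] minus 7 top faces, B(15,2)) (r = 121) the fraction-merged order interleaves the
two sides ≈ 1 : 2 and its ordered specialisation is singular for every weight draw (Hall for the Möbius support holds; rank obstruction), whereas
the orders «wide side first» work. No kernel refutation is offered (a 56 × 56 symbolic determinant); planners must NOT register `conjStarMassMerge`.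

THE CORRECTED RULE «CM». Same masses (`rowMass u b = #{i : b ∈ u i} − 1`) and the same within-side sort, but the two sides are merged by ABSOLUTE
cumulative mass: the row vertex `b` precedes the column vertex `e` iff `rowCum u b ≤ rowCum w e` (ties to the row side). Positions `cmRowPos u b =
2 · rowCum u b`, `cmColPos w e = 2 · rowCum w e + 1`. A deep side (few vertices, big links) therefore comes almost entirely AFTER a wide side (many
vertices, small links) — the evaluation door `E` on (cube, points/graphs) — while sides of comparable mass interleave (≈ 3 : 2 on the rigid family).
CENSUS of CM (lab exp30/exp31; kit j338460 running at filing): 0 failures on all 1 975 lower pairs on ≤ 5+5 vertices, ≈ 450 random pairs on 3+7 … 9+9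
vertices (r ≤ 452), the 16 named pairs of …StarMassMerge, the three deep-wide pairs above, cones and disjoint unions of them (r ≤ 242), cube₆ vs
B(7,3); the variant with mass' = Σ_{S ∋ v} (|S| − 1) is also clean. WHY IT MIGHT FAIL: one injective lower pair on which the CM-ordered specialisation is
singular — a finite computation per pair.
-/

set_option linter.dupNamespace false

namespace Summit.ValiantsHypothesis.ValiantsHypothesis.Theorems.BarrierLever.AnchoredPeeling

open Finset

noncomputable section

namespace StarDoor

variable {h r : ℕ}

/-- CM position of the row vertex `b`: twice its cumulative mass (even). -/
def cmRowPos (u : Fin r → Finset (Fin h)) (b : Fin h) : ℕ := 2 * rowCum u b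

/-- CM position of the column vertex `e`: twice its cumulative mass plus one (odd), so `e` precedes `b` iff `rowCum w e < rowCum u b`. -/
def cmColPos (w : Fin r → Finset (Fin h)) (e : Fin h) : ℕ := 2 * rowCum w e + 1

/-- The CM positions never tie across the sides. -/
theorem cmRowPos_ne_cmColPos (u w : Fin r → Finset (Fin h)) (b e : Fin h) : cmRowPos u b ≠ cmColPos w e := by
  unfold cmRowPos cmColPos
  omega

/-- **CM-consistent positions**: a row vertex of strictly smaller cumulative mass precedes a column vertex, and vice versa; vertices of EQUAL
cumulative mass on the two sides may be placed either way (ties are free — on `(2^[7] − 7 top faces, B(15,2))` exactly one of the two tie-breaks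
works, lab/exp33). `cmRowPos`, `cmColPos` (ties to the row side) are one CM-consistent choice (`isCMConsistent_cmPos`). -/
def IsCMConsistent (u w : Fin r → Finset (Fin h)) (π σ : Fin h → ℕ) : Prop :=
  (∀ b e, rowCum u b < rowCum w e → π b < σ e) ∧ (∀ b e, rowCum w e < rowCum u b → σ e < π b)

/-- The canonical CM positions are CM-consistent. -/
theorem isCMConsistent_cmPos (u w : Fin r → Finset (Fin h)) : IsCMConsistent u w (cmRowPos u) (cmColPos w) := by
  refine ⟨fun b e hlt => ?_, fun b e hlt => ?_⟩ <;> unfold cmRowPos cmColPos <;> omega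

end StarDoor

/-- **NODE TEXT (val-np-p1 g36): THE CUMULATIVE-MASS ORDER WORKS.** For all `h`, `r` and every pair of injective enumerations `u`, `w` of LOWER
families of faces of the same size there are positions `π`, `σ` CONSISTENT WITH CUMULATIVE MASS (`StarDoor.IsCMConsistent`: each side sorted by
mass = number of faces through the vertex minus one, the sides merged by absolute cumulative mass, ties free) and complex weights `g d` ORDERED
for them (`StarDoor.IsOrdered π σ g d`: every leaf hangs on an EARLIER centre) with nonsingular star-forest block. Implies `Stmt.conjStarOrdered`.
WHY IT MIGHT FAIL: one lower pair all of whose CM-consistent ordered specialisations are singular (none among ≈ 2 500 pairs incl. every pair on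
≤ 5+5 vertices, the deep-wide pairs `(2^[k] − t, B(n,2))` (k ≤ 7) that refute the fraction rule, cubes vs `B(n,3)` (r ≤ 128), shifted and pure
complexes, crossing disjoint unions (r ≤ 241); the variant mass' = `Σ_{S ∋ v} (|S| − 1)` is also clean, lab/exp30–35, kit j338460). -/
def Stmt.conjStarCumulativeMass : Prop :=
  ∀ (h r : ℕ) (u w : Fin r → Finset (Fin h)), Function.Injective u → Function.Injective w →
    IsLowerSet (Set.range u) → IsLowerSet (Set.range w) →
    ∃ (π σ : Fin h → ℕ) (g d : Fin h → Fin h → ℂ), StarDoor.IsCMConsistent u w π σ ∧ StarDoor.IsOrdered π σ g d ∧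
      (Matrix.of fun i j : Fin r => StarDoor.starEntry g d (u i) (w j)).det ≠ 0

/-- CM ⟹ ORDERED STAR-LOWER. -/
theorem conjStarOrdered_of_conjStarCumulativeMass (H : Stmt.conjStarCumulativeMass) : Stmt.conjStarOrdered := by
  intro h r u w hu hw hlu hlw
  obtain ⟨π, σ, g, d, _, ho, hdet⟩ := H h r u w hu hw hlu hlw
  exact ⟨π, σ, g, d, ho, hdet⟩

/-- **COMPOSITION BY NAME: `Stmt.conjStarCumulativeMass → AnchoredDoorHitsLowerPairs`.** -/
theorem anchoredDoorHitsLowerPairs_of_conjStarCumulativeMass (H : Stmt.conjStarCumulativeMass) :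
    Summit.ValiantsHypothesis.ValiantsHypothesis.Theses.BarrierLever.AnchoredDoorHitsLowerPairs :=
  anchoredDoorHitsLowerPairs_of_conjStarOrdered (conjStarOrdered_of_conjStarCumulativeMass H)

end

end Summit.ValiantsHypothesis.ValiantsHypothesis.Theorems.BarrierLever.AnchoredPeeling
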